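import Literature.Analysis.FluidPDE.TaoH1FourierMild
import Literature.Analysis.FluidPDE.FourierL2PicardLimit
import HarnessLib

/-!
# Tao (2011/2013), Thm. 5.4 (ii) on the Fourier side: discharge of `tao2011_sobolevMild_exists`

T. Tao, *Localisation and compactness properties of the Navier–Stokes global regularity problem*,
Anal. PDE 6 (2013) 25–107 = arXiv:1108.1165, Thm. 5.4 (ii) = arXiv Thm. 31 (ii), p. 18:
"If `(‖u₀‖_{H¹_x(ℝ³)} + ‖f‖_{L¹_t H¹_x(ℝ³)})⁴ T ≤ c` for a sufficiently small absolute constant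
`c > 0`, then there exists a `H¹` mild solution `(u, p, u₀, f, T)` with the indicated data",
proved (p. 18: "by repeating the proof of Theorem 28 verbatim", i.e. the contraction of the
Duhamel map in `X¹ = L^∞_t H¹_x ∩ L²_t H²_x`, p. 16, closed by the energy estimate (energy-duh2)
and the bilinear estimate (bilinear-2) of Lemma 23, p. 10).

This file proves the tree's Fourier-side rendering
`Literature.Analysis.FluidPDE.tao2011_sobolevMild_exists` (`TaoH1FourierMild.lean`: `f = 0`,
viscosity `ν > 0` by the footnote-3 rescaling, datum of Sobolev class given through its transform
`a`, smallness `(∫ (1 + 4π²‖ξ‖²)|a|²)² T ≤ c₀ ν³`, conclusion `IsSobolevMild (4π²ν) T a v`) by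
**assembling the weighted-`L²` Picard scheme of the tree** (`FourierL2Convolution` → … →
`FourierL2PicardLimit`, the Fourier-side run of exactly this `X¹` contraction for the iterates
`picardIter c T a n` of `NSFourierPicard`): under the scale-invariant smallness condition `hs` of
`FourierL2PicardCauchy`/`FourierL2PicardLimit` (an absolute `ℝ≥0∞` constant times
`c⁻¹ (2T/c)^{1/2} ∫ (‖η‖ ∑ⱼ |aⱼ(η)|)² dη ≤ 1`, `c = 4π²ν`) the pointwise limit
`v = picardLimit c T a` solves the clamped Duhamel equation at every `(t, ξ)`
(`picardLimit_eq_duhamel`), its Duhamel part `heat • a − v` is jointly continuous with pointwise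
polynomial decay of every order uniformly in time (`continuous_hsub_picardLimit`,
`exists_hasDecay_hsub_picardLimit`), its slices are measurable (`aestronglyMeasurable_picardLimit`),
and it is divergence free and conjugation symmetric (`sum_mul_picardLimit`,
`picardLimit_conj_symm`). What is added here:

* `IsSobolevFourierDatum.lintegral_weight_apply_sq_lt_top` — the componentwise weighted moments
  `∫ ((1+‖η‖)^k |aⱼ|)² < ∞` of a datum of Sobolev class;
* `lintegral_norm_mul_majorant_sq_le_fourierH1Sq` — `∫ (‖η‖ ∑ⱼ|aⱼ|)² ≤ (9/(4π²)) · fourierH1Sq a`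
  (Cauchy–Schwarz on the three components);
* `picardSmallConst_ne_top` and `picard_smallness_of_fourierH1Sq` — the scheme's constant `C` is
  finite, and with the absolute constant `c₀ = 1024π¹⁰/(162 C² + 1)` (`C` taken as a real number;
  no definitions are introduced, the constants are written out) the hypotheses
  `fourierH1Sq a ≤ A`, `A² T ≤ c₀ ν³` imply the scheme's condition `hs` (square both sides:
  `C² c⁻² (2T/c) (9A/(4π²))² = 162 C² A² T / (1024 π¹⁰ ν³)`);
* `tao2011_sobolevMild_exists_holds` — the discharge, with this `c₀`.

## Mathlib / tree search

Tree (`lean search picardLimit`, `IsSobolevMild`, `fourierH1Sq`): everything listed above, in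
`Literature.Analysis.FluidPDE.FourierNS` (`FourierL2PicardLimit`, `FourierL2PicardClass`,
`NSFourierPicard`) and `Literature.Analysis.FluidPDE` (`TaoH1FourierMild`,
`TaoH1FourierDecomposition`). Mathlib: `sq_sum_le_card_mul_sum_sq`, `ENNReal.ofReal_rpow_of_nonneg`,
`ENNReal.ofReal_le_one`, `sq_le_one_iff₀`, `SNormLESNormFDerivOfEqConst` (the Sobolev constant
entering the scheme's constant).

## References

* T. Tao, arXiv:1108.1165 = Anal. PDE 6 (2013): Thm. 5.4 (ii) = arXiv Thm. 31 (ii), p. 18, with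
  the proof of Thm. 28 (p. 16) and Lemma 23 (p. 10). [Tao2011]
* J. Leray, Acta Math. 63 (1934), §19 (successive approximations for the regular solution).
  [Leray1934]
-/

noncomputable section

open MeasureTheory Set Function Filter Real Complex
open scoped ENNReal NNReal ComplexConjugate
open _root_.Topology

namespace Literature.Analysis.FluidPDE

open FourierNS

/-! ### The datum: componentwise moments and the `Ḣ¹` majorant moment -/

namespace FourierNS

variable {ι : Type*} [Fintype ι] {a : EuclideanSpace ℝ ι → ι → ℂ}

omit [Fintype ι] in
/-- **Componentwise weighted moments of a datum of Sobolev class**: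
`∫ ((1 + ‖η‖)^k |aⱼ(η)|)² dη < ∞` for every `k` and `j` (the component is dominated by the sum
over components, `(1+‖η‖)^{2k} = ((1+‖η‖)^k)²`). [folklore] -/
theorem IsSobolevFourierDatum.lintegral_weight_apply_sq_lt_top [Fintype ι]
    (ha : IsSobolevFourierDatum a) (k : ℕ) (j : ι) :
    ∫⁻ η, (ENNReal.ofReal ((1 + ‖η‖) ^ k) * ‖a η j‖ₑ) ^ 2 < ⊤ := by
  refine lt_of_le_of_lt (lintegral_mono fun η => ?_) (ha.moments k)
  rw [mul_pow, ← ENNReal.ofReal_pow (by positivity), ← pow_mul, mul_comm k 2]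
  gcongr
  exact Finset.single_le_sum (f := fun l => ‖a η l‖ₑ ^ 2) (fun l _ => by positivity)
    (Finset.mem_univ j)

end FourierNS

/-- **The `Ḣ¹` majorant moment is dominated by the `H¹` quantity**:
`∫ (‖η‖ ∑ⱼ |aⱼ(η)|)² dη ≤ (9 / (4π²)) ∫ (1 + 4π²‖η‖²) ∑ⱼ |aⱼ(η)|² dη`
(`(∑ⱼ xⱼ)² ≤ 3 ∑ⱼ xⱼ²` on the three components and `3‖η‖² ≤ (9/(4π²))(1 + 4π²‖η‖²)`).
[folklore] -/
theorem lintegral_norm_mul_majorant_sq_le_fourierH1Sq (a : EuclideanSpace ℝ (Fin 3) → Fin 3 → ℂ) :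
    ∫⁻ η, (ENNReal.ofReal ‖η‖ * ∑ j, ‖a η j‖ₑ) ^ 2 ≤
      ENNReal.ofReal (9 / (4 * π ^ 2)) * fourierH1Sq a := by
  rw [fourierH1Sq_eq, ← lintegral_const_mul' _ _ ENNReal.ofReal_ne_top]
  refine lintegral_mono fun η => ?_
  have h1 : ENNReal.ofReal ‖η‖ * ∑ j, ‖a η j‖ₑ = ENNReal.ofReal (‖η‖ * ∑ j, ‖a η j‖) := by
    rw [ENNReal.ofReal_mul (norm_nonneg _), ENNReal.ofReal_sum_of_nonneg (fun j _ => norm_nonneg _)]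
    congr 1
    exact Finset.sum_congr rfl fun j _ => (ofReal_norm (a η j)).symm
  have h2 : ENNReal.ofReal (1 + 4 * π ^ 2 * ‖η‖ ^ 2) * ∑ l, ‖a η l‖ₑ ^ 2 =
      ENNReal.ofReal ((1 + 4 * π ^ 2 * ‖η‖ ^ 2) * ∑ l, ‖a η l‖ ^ 2) := by
    rw [ENNReal.ofReal_mul (by positivity), ENNReal.ofReal_sum_of_nonneg (fun l _ => sq_nonneg _)]
    congr 1
    refine Finset.sum_congr rfl fun l _ => ?_
    rw [ENNReal.ofReal_pow (norm_nonneg _), ofReal_norm]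
  rw [h1, ← ENNReal.ofReal_pow (by positivity), h2, ← ENNReal.ofReal_mul (by positivity)]
  refine ENNReal.ofReal_le_ofReal ?_
  set S : ℝ := ∑ j, ‖a η j‖ ^ 2 with hS
  have hS0 : 0 ≤ S := Finset.sum_nonneg fun j _ => sq_nonneg _
  have hcs : (∑ j, ‖a η j‖) ^ 2 ≤ 3 * S := by
    have h := sq_sum_le_card_mul_sum_sq (s := (Finset.univ : Finset (Fin 3))) (f := fun j => ‖a η j‖)
    simpa [hS] using h
  have hπ : 0 < π ^ 2 := by positivity
  have hkey : 9 / (4 * π ^ 2) * ((1 + 4 * π ^ 2 * ‖η‖ ^ 2) * S) =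
      9 / (4 * π ^ 2) * S + 9 * (‖η‖ ^ 2 * S) := by
    field_simp
  rw [mul_pow, hkey]
  have h3 : ‖η‖ ^ 2 * (∑ j, ‖a η j‖) ^ 2 ≤ ‖η‖ ^ 2 * (3 * S) :=
    mul_le_mul_of_nonneg_left hcs (sq_nonneg _)
  have h4 : 0 ≤ 9 / (4 * π ^ 2) * S := by positivity
  have h5 : 0 ≤ ‖η‖ ^ 2 * S := by positivity
  nlinarith [h3, h4, h5]

/-! ### The smallness condition of the `L²` Picard scheme from `‖a‖⁴_{H¹} T ≤ c₀ ν³` -/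

/-- **The constant of the weighted-`L²` Picard scheme is finite**: the absolute `ℝ≥0∞` constant
`2304 · (4π · 3²)² · ((S · 2π)^{3/2})²` of the smallness condition of `FourierL2PicardCauchy` /
`FourierL2PicardLimit` (`S` Mathlib's Sobolev constant `SNormLESNormFDerivOfEqConst ℂ volume 2` on
`ℝ³`, an `ℝ≥0`) is not `⊤`. [folklore] -/
theorem picardSmallConst_ne_top :
    (2304 * (ENNReal.ofReal (4 * π) * (Fintype.card (Fin 3) : ℝ≥0∞) ^ 2) ^ 2 *
      ((SNormLESNormFDerivOfEqConst ℂ (volume : Measure (EuclideanSpace ℝ (Fin 3))) 2 *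
        ENNReal.ofReal (2 * π)) ^ (3 / 2 : ℝ)) ^ 2 : ℝ≥0∞) ≠ ⊤ := by
  refine ENNReal.mul_ne_top (ENNReal.mul_ne_top (by norm_num) (ENNReal.pow_ne_top ?_))
    (ENNReal.pow_ne_top ?_)
  · exact ENNReal.mul_ne_top ENNReal.ofReal_ne_top (ENNReal.pow_ne_top (ENNReal.natCast_ne_top _))
  · exact ENNReal.rpow_ne_top_of_nonneg (by norm_num)
      (ENNReal.mul_ne_top ENNReal.coe_ne_top ENNReal.ofReal_ne_top)

/-- **Smallness.** For a finite constant `C`, `ν > 0`, `T > 0`, `fourierH1Sq a ≤ A` and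
`A² T ≤ c₀ ν³` with `c₀ = 1024 π¹⁰ / (162 C² + 1)` (`C` taken as a real number), the condition
`hs` of the weighted-`L²` Picard scheme holds with `c = 4π²ν`:
`C · c⁻¹ · (T · 2/c)^{1/2} · ∫ (‖η‖ ∑ⱼ|aⱼ|)² ≤ 1` (bound the moment by `9A/(4π²)` and square:
`C² c⁻² (2T/c) (9A/(4π²))² = 162 C² A² T / (1024 π¹⁰ ν³) ≤ 1`).
[cite: Tao2011, Thm. 5.4 (ii) (arXiv Thm. 31 (ii), hypothesis (D4))] -/
theorem picard_smallness_of_fourierH1Sq {C : ℝ≥0∞} (hCtop : C ≠ ⊤) {ν T A : ℝ}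
    {a : EuclideanSpace ℝ (Fin 3) → Fin 3 → ℂ}
    (hν : 0 < ν) (hT : 0 < T) (hA : 0 ≤ A) (hH1 : fourierH1Sq a ≤ ENNReal.ofReal A)
    (hsmall : A ^ 2 * T ≤ 1024 * π ^ 10 / (162 * C.toReal ^ 2 + 1) * ν ^ 3) :
    C * ENNReal.ofReal (4 * π ^ 2 * ν)⁻¹ *
        (ENNReal.ofReal T * ENNReal.ofReal (2 / (4 * π ^ 2 * ν))) ^ (1 / 2 : ℝ) *
        (∫⁻ η, (ENNReal.ofReal ‖η‖ * ∑ j, ‖a η j‖ₑ) ^ 2) ≤ 1 := by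
  set c : ℝ := 4 * π ^ 2 * ν with hc
  have hcpos : 0 < c := by positivity
  set Cr : ℝ := C.toReal with hCr
  have hCr0 : 0 ≤ Cr := ENNReal.toReal_nonneg
  have hC : C = ENNReal.ofReal Cr := by
    rw [hCr, ENNReal.ofReal_toReal hCtop]
  -- the moment
  have hM : ∫⁻ η, (ENNReal.ofReal ‖η‖ * ∑ j, ‖a η j‖ₑ) ^ 2 ≤ ENNReal.ofReal (9 / (4 * π ^ 2) * A) := by
    calc ∫⁻ η, (ENNReal.ofReal ‖η‖ * ∑ j, ‖a η j‖ₑ) ^ 2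
        ≤ ENNReal.ofReal (9 / (4 * π ^ 2)) * fourierH1Sq a := lintegral_norm_mul_majorant_sq_le_fourierH1Sq a
      _ ≤ ENNReal.ofReal (9 / (4 * π ^ 2)) * ENNReal.ofReal A := mul_le_mul' le_rfl hH1
      _ = ENNReal.ofReal (9 / (4 * π ^ 2) * A) := (ENNReal.ofReal_mul (by positivity)).symm
  -- the time factor
  have hroot : (ENNReal.ofReal T * ENNReal.ofReal (2 / c)) ^ (1 / 2 : ℝ) =
      ENNReal.ofReal (Real.sqrt (T * (2 / c))) := by
    rw [← ENNReal.ofReal_mul hT.le, ENNReal.ofReal_rpow_of_nonneg (by positivity) (by norm_num),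
      Real.sqrt_eq_rpow]
  -- the real quantity
  set r : ℝ := Cr * c⁻¹ * Real.sqrt (T * (2 / c)) * (9 / (4 * π ^ 2) * A) with hr
  have hr0 : 0 ≤ r := by positivity
  have hr2 : r ^ 2 = 162 * Cr ^ 2 * A ^ 2 * T / (1024 * π ^ 10 * ν ^ 3) := by
    have hs2 : Real.sqrt (T * (2 / c)) ^ 2 = T * (2 / c) := Real.sq_sqrt (by positivity)
    have hπ : (π : ℝ) ≠ 0 := Real.pi_pos.ne'
    have hν0 : ν ≠ 0 := hν.ne'
    simp only [hr]
    rw [mul_pow, mul_pow, mul_pow, hs2, hc]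
    field_simp
    ring
  have hr1 : r ≤ 1 := by
    rw [← sq_le_one_iff₀ hr0, hr2, div_le_one (by positivity)]
    have hden : 0 < 162 * Cr ^ 2 + 1 := by positivity
    have h1 : A ^ 2 * T * (162 * Cr ^ 2 + 1) ≤ 1024 * π ^ 10 * ν ^ 3 := by
      have := hsmall
      rw [div_mul_eq_mul_div, le_div_iff₀ hden] at this
      linarith
    have h2 : 0 ≤ A ^ 2 * T := by positivity
    nlinarith [h1, h2]
  -- assemble in `ℝ≥0∞`
  rw [hC, hroot]
  calc ENNReal.ofReal Cr * ENNReal.ofReal c⁻¹ * ENNReal.ofReal (Real.sqrt (T * (2 / c))) *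
        ∫⁻ η, (ENNReal.ofReal ‖η‖ * ∑ j, ‖a η j‖ₑ) ^ 2
      ≤ ENNReal.ofReal Cr * ENNReal.ofReal c⁻¹ * ENNReal.ofReal (Real.sqrt (T * (2 / c))) *
          ENNReal.ofReal (9 / (4 * π ^ 2) * A) := mul_le_mul' le_rfl hM
    _ = ENNReal.ofReal r := by
        rw [hr, ← ENNReal.ofReal_mul (p := Cr) (q := c⁻¹) hCr0,
          ← ENNReal.ofReal_mul (p := Cr * c⁻¹) (q := Real.sqrt (T * (2 / c))) (by positivity),
          ← ENNReal.ofReal_mul (p := Cr * c⁻¹ * Real.sqrt (T * (2 / c)))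
            (q := 9 / (4 * π ^ 2) * A) (by positivity)]
    _ ≤ 1 := ENNReal.ofReal_le_one.2 hr1

/-! ### The discharge -/

/-- **Tao 2011, Thm. 5.4 (ii), Fourier side: `tao2011_sobolevMild_exists` holds.** With the
absolute constant `c₀ = 1024 π¹⁰ / (162 C² + 1)`, `C` the (real value of the) constant of the
weighted-`L²` Picard scheme (`picardSmallConst_ne_top`): for `ν > 0`, `T > 0`, a datum `a` of
Sobolev class with `fourierH1Sq a ≤ A` and `A² T ≤ c₀ ν³`, the pointwise limit
`v = picardLimit (4π²ν) T a` of the Picard iterates of the clamped Duhamel map (the Fourier-side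
run of Tao's `X¹` contraction, `FourierL2PicardLimit`) is an `IsSobolevMild (4π²ν) T a v`:
measurable slices, continuity in time at every frequency (`v = heat • a − E`, `E` jointly
continuous), the fixed-point identity at every `(t, ξ)`, decay of every order of the Duhamel
part, the divergence-free relation and the conjugation symmetry. [cite: Tao2011, Thm. 5.4 (ii)
(arXiv Thm. 31 (ii), p. 18; proof of Thm. 28, p. 16; Lemma 23, p. 10)] -/
theorem tao2011_sobolevMild_exists_holds : tao2011_sobolevMild_exists := by
  refine ⟨1024 * π ^ 10 / (162 * ENNReal.toReal
    (2304 * (ENNReal.ofReal (4 * π) * (Fintype.card (Fin 3) : ℝ≥0∞) ^ 2) ^ 2 *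
      ((SNormLESNormFDerivOfEqConst ℂ (volume : Measure (EuclideanSpace ℝ (Fin 3))) 2 *
        ENNReal.ofReal (2 * π)) ^ (3 / 2 : ℝ)) ^ 2 : ℝ≥0∞) ^ 2 + 1), by positivity, ?_⟩
  intro ν T hν hT a ha _hm A hA hH1 hsmall
  have hs := picard_smallness_of_fourierH1Sq picardSmallConst_ne_top (a := a) hν hT hA hH1 hsmall
  set c : ℝ := 4 * π ^ 2 * ν with hc
  have hcpos : 0 < c := by positivity
  have ham : AEStronglyMeasurable a volume := ha.meas
  have haw : ∀ (k : ℕ) (j : Fin 3), ∫⁻ η, (ENNReal.ofReal ((1 + ‖η‖) ^ k) * ‖a η j‖ₑ) ^ 2 < ⊤ :=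
    fun k j => ha.lintegral_weight_apply_sq_lt_top k j
  have hEc := continuous_hsub_picardLimit hcpos hT.le ham haw hs
  refine ⟨picardLimit c T a, ?_⟩
  exact
    { meas := fun t => aestronglyMeasurable_picardLimit hcpos hT.le ham haw hs t
      cont := fun ξ => by
        have h1 : Continuous fun t : ℝ => heat c ξ (clamp T t) • a ξ :=
          (continuous_heat_comp c continuous_const (continuous_clamp T)).smul continuous_const
        have h2 : Continuous fun t : ℝ => heat c ξ (clamp T t) • a ξ - picardLimit c T a t ξ :=
          hEc.uncurry_right ξ
        have heq : (fun t : ℝ => picardLimit c T a t ξ) = fun t =>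
            heat c ξ (clamp T t) • a ξ - (heat c ξ (clamp T t) • a ξ - picardLimit c T a t ξ) := by
          funext t; rw [sub_sub_cancel]
        rw [heq]
        exact h1.sub h2
      fixed := fun t ξ => picardLimit_eq_duhamel hcpos hT.le ham haw hs t ξ
      decay := fun K => by
        obtain ⟨B, hB⟩ := exists_hasDecay_hsub_picardLimit hcpos hT.le ham haw hs K
        refine ⟨B, fun t ξ => ?_⟩
        have h := hB t ξ
        have hw : (0 : ℝ) < (1 + ‖ξ‖) ^ K := by positivity
        rw [norm_sub_rev]
        calc (1 + ‖ξ‖) ^ K * ‖heat c ξ (clamp T t) • a ξ - picardLimit c T a t ξ‖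
            ≤ (1 + ‖ξ‖) ^ K * (B * ((1 + ‖ξ‖) ^ K)⁻¹) := mul_le_mul_of_nonneg_left h hw.le
          _ = B := by field_simp
      divFree := fun t ξ => sum_mul_picardLimit hcpos hT.le ham haw hs ha.divFree t ξ
      conjSymm := fun t ξ l => picardLimit_conj_symm hcpos hT.le ham haw hs ha.conjSymm t ξ l }

end Literature.Analysis.FluidPDE

end
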